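import Mathlib
import Summits.Ventures.HodgeRepro2.InvariantFormsGroup
import Summits.Ventures.HodgeRepro2.BallHomogeneous

/-!
# The ball action is analytic; the ball is a complex manifold

Kernel annex of the blind cell `pub-hodge-repro2` (seat p2), Tier-3 hypothesis shapes of
`Hypothesis.lean`.  The transfer of the brief lives on a compact quotient `Γ\𝔹²` of the complex
2-ball by a discrete group acting through `ballAction` (Shimura 1979 §4, DR15 §2).  This file
records that the ball action of an element of `U(2,1)` is `C^ω` (complex analytic) on the ball,
not merely ℂ-differentiable (`IsInU21.differentiableAt_ballAction` of `InvariantFormsGroup`), and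
that the ball itself, as an open subset of `ℂ²`, is an analytic complex manifold modelled on
`Fin 2 → ℂ` in Mathlib's sense (`IsManifold 𝓘(ℂ, Fin 2 → ℂ) ω`), exactly as Mathlib treats the
upper half-plane (`UpperHalfPlane.instIsManifoldComplexModelWithCornersSelfTopOmega`).

The `C^ω` statement is what the quotient needs: the transition maps of the charts of `Γ\𝔹²`
are (locally) ball actions of elements of `Γ`, so `Γ\𝔹²` inherits an analytic atlas
(`BallQuotientComplexManifold.lean`).
-/

namespace Summit.Ventures.HodgeRepro2.ShimuraData

open scoped ContDiff Manifold

/-- The homogenisation `z ↦ (z, 1)` is `C^ω` (it is affine). -/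
theorem contDiff_homog : ContDiff ℂ ω homog := by
  refine contDiff_pi.2 fun j => ?_
  refine Fin.lastCases ?_ (fun k => ?_) j
  · simp only [homog_last]
    exact contDiff_const
  · simp only [homog_castSucc]
    exact contDiff_apply ℂ ℂ k

/-- `z ↦ α · (z, 1)` is `C^ω` for every matrix `α` (linear after the affine homogenisation). -/
theorem contDiff_mulVec_homog (α : Matrix (Fin 3) (Fin 3) ℂ) :
    ContDiff ℂ ω fun z : Fin 2 → ℂ => α.mulVec (homog z) := by
  have hlin : ContDiff ℂ ω fun v : Fin 3 → ℂ => α.mulVec v :=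
    (LinearMap.toContinuousLinearMap (Matrix.mulVecLin α)).contDiff
  exact hlin.comp contDiff_homog

/-- Each coordinate of `z ↦ α · (z, 1)` is `C^ω`. -/
theorem contDiff_mulVec_homog_apply (α : Matrix (Fin 3) (Fin 3) ℂ) (i : Fin 3) :
    ContDiff ℂ ω fun z : Fin 2 → ℂ => α.mulVec (homog z) i :=
  contDiff_pi.1 (contDiff_mulVec_homog α) i

/-- The ball action of `α ∈ U(2,1)` is `C^ω` at every point of the ball: each coordinate is the
quotient of two affine functions of `z`, and the denominator `(α · (z,1))₃` does not vanish on
the ball (`IsInU21.mulVec_homog_last_ne_zero`). -/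
theorem IsInU21.contDiffAt_ballAction {α : Matrix (Fin 3) (Fin 3) ℂ} (hα : IsInU21 α)
    {z : Fin 2 → ℂ} (hz : z ∈ ball₂) : ContDiffAt ℂ ω (ballAction α) z := by
  refine contDiffAt_pi.2 fun k => ?_
  have hnum : ContDiffAt ℂ ω (fun w : Fin 2 → ℂ => α.mulVec (homog w) k.castSucc) z :=
    (contDiff_mulVec_homog_apply α k.castSucc).contDiffAt
  have hden : ContDiffAt ℂ ω (fun w : Fin 2 → ℂ => α.mulVec (homog w) (Fin.last 2)) z :=
    (contDiff_mulVec_homog_apply α (Fin.last 2)).contDiffAt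
  exact hnum.div hden (hα.mulVec_homog_last_ne_zero hz)

/-- The ball action of `α ∈ U(2,1)` is `C^ω` on the ball. -/
theorem IsInU21.contDiffOn_ballAction {α : Matrix (Fin 3) (Fin 3) ℂ} (hα : IsInU21 α) :
    ContDiffOn ℂ ω (ballAction α) ball₂ :=
  fun _ hz => (hα.contDiffAt_ballAction hz).contDiffWithinAt

/-- The ball action of `α ∈ U(2,1)` is complex analytic at every point of the ball. -/
theorem IsInU21.analyticAt_ballAction {α : Matrix (Fin 3) (Fin 3) ℂ} (hα : IsInU21 α)
    {z : Fin 2 → ℂ} (hz : z ∈ ball₂) : AnalyticAt ℂ (ballAction α) z :=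
  (hα.contDiffAt_ballAction hz).analyticAt

/-- The ball action of `α ∈ U(2,1)` is complex analytic on a neighbourhood of every point of
the ball. -/
theorem IsInU21.analyticOnNhd_ballAction {α : Matrix (Fin 3) (Fin 3) ℂ} (hα : IsInU21 α) :
    AnalyticOnNhd ℂ (ballAction α) ball₂ :=
  fun _ hz => hα.analyticAt_ballAction hz

/-- The ball is non-empty (it contains the origin `ballOrigin` of `BallHomogeneous.lean`). -/
instance ball₂.instNonempty : Nonempty ball₂ := ⟨ballOrigin⟩

/-- The inclusion of the ball into `ℂ²` is an open embedding. -/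
theorem isOpenEmbedding_ball₂_val : Topology.IsOpenEmbedding (Subtype.val : ball₂ → Fin 2 → ℂ) :=
  isOpen_ball₂.isOpenEmbedding_subtypeVal

/-- The ball, as an open subset of `ℂ²`, is charted by the single chart `Subtype.val`
(the same construction Mathlib uses for the upper half-plane). -/
noncomputable instance ball₂.instChartedSpace : ChartedSpace (Fin 2 → ℂ) ball₂ :=
  isOpenEmbedding_ball₂_val.singletonChartedSpace

/-- The chart of the ball at any point is the inclusion. -/
theorem ball₂.coe_chartAt (z : ball₂) :
    ⇑(chartAt (Fin 2 → ℂ) z) = (Subtype.val : ball₂ → Fin 2 → ℂ) :=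
  rfl

/-- The chart of the ball has source the whole ball. -/
theorem ball₂.chartAt_source (z : ball₂) : (chartAt (Fin 2 → ℂ) z).source = Set.univ :=
  Topology.IsOpenEmbedding.toOpenPartialHomeomorph_source _ _

/-- The chart of the ball has target the ball (as a subset of `ℂ²`). -/
theorem ball₂.chartAt_target (z : ball₂) : (chartAt (Fin 2 → ℂ) z).target = ball₂ := by
  rw [show (chartAt (Fin 2 → ℂ) z).target = Set.range (Subtype.val : ball₂ → Fin 2 → ℂ) from
    Topology.IsOpenEmbedding.toOpenPartialHomeomorph_target _ _]
  exact Subtype.range_coe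

/-- The inverse chart of the ball sends `w ∈ 𝔹²` to the point `w` of the ball. -/
theorem ball₂.coe_chartAt_symm_apply (z : ball₂) {w : Fin 2 → ℂ} (hw : w ∈ ball₂) :
    ((chartAt (Fin 2 → ℂ) z).symm w : Fin 2 → ℂ) = w := by
  have : w ∈ (chartAt (Fin 2 → ℂ) z).target := by rwa [ball₂.chartAt_target]
  exact (chartAt (Fin 2 → ℂ) z).right_inv this

/-- The ball is an analytic complex manifold modelled on `ℂ²`. -/
instance ball₂.instIsManifold : IsManifold 𝓘(ℂ, Fin 2 → ℂ) ω ball₂ :=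
  isOpenEmbedding_ball₂_val.isManifold_singleton

/-- The ball is a topological manifold modelled on `ℂ²` (the `C^0` case of the above). -/
instance ball₂.instIsManifoldZero : IsManifold 𝓘(ℂ, Fin 2 → ℂ) 0 ball₂ :=
  IsManifold.of_le (n := ω) bot_le

end Summit.Ventures.HodgeRepro2.ShimuraData
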